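import Literature.NumberTheory.Sieve.FriedlanderIwaniecPrimesThresholdSeparation
import Mathlib.NumberTheory.ArithmeticFunction.Moebius
import HarnessLib

/-!
# Friedlander–Iwaniec, *The polynomial `X² + Y⁴` captures its primes*, §25/§26: separation of a product cutoff, of a weight of bounded variation and of a coprimality condition inside a bilinear form

Family `parity` (Line A, node (vi): the reduction of Proposition 17.2, §25). Source: J. Friedlander,
H. Iwaniec, Ann. of Math. (2) 148 (1998), 945–1040 [FriedlanderIwaniecAnnals1998]
(= arXiv:math/9811185), §25 "Estimation of `S^k_χ(β')`" (arXiv pp. 83–84) and §26: the bilinear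
forms `T(c, 𝔡)`, `T(c)`, `ℒ*(A, B)` of §25 are brought to the shape of Proposition 23.1 "after
splitting into dyadic boxes, normalizing the coefficients, and separating the variables in `g(cℓ)` via
the Mellin transform" (p. 84), the product condition `mn ≤ x` being separated by Lemma 26.1
[tree: `lemma261`] ("useful for separating integral variables `m, n` constrained by an inequality
`mn ≤ x`", p. 84), and the restricted forms `ℒ*` (coprime variables, (23.7)) being reduced to
unrestricted ones (proof of Proposition 23.1, p. 81: "Finally we remove the condition `(m, n) = 1`").

This file PROVES these three devices once, as transformers of the predicate `BilinBoundedBy`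
[tree: `…ThresholdSeparation`] ("every bilinear form in the kernel `K` over `W × Z` with
coefficients bounded by `1` has norm `≤ X`"), for arbitrary index types with "size" maps
`u : ι → ℕ`, `v : κ → ℕ` into the positive integers:

* `BilinBoundedBy.cutoff` — the product cutoff `[u(w) v(z) ≤ y]` costs a factor `log 6y`
  (Lemma 26.1: `[k ≤ y] = ∫ h_y(t) k^{it} dt`, `∫|h_y| < log 6y`, and `k^{it} = u^{it} v^{it}` is a
  product of unimodular functions of each variable).
* `BilinBoundedBy.bvWeight` — a weight `g(u(w) v(z))` with `g` vanishing beyond `U` costs the factor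
  `V(g) · log 6U`, `V(g) = Σ_{y ≤ U} |g(y) - g(y+1)|` its total variation (Abel summation
  `g(k) = Σ_{y ≥ k} (g(y) - g(y+1))` turns the weight into a superposition of cutoffs; this replaces
  the Mellin transform of the source and needs no smoothness).
* `BilinBoundedBy.coprime` — the condition `(u(w), v(z)) = 1` costs a factor `B₀` plus the trivial
  bound over the pairs with `gcd > B₀` (Möbius inversion truncated at `B₀`:
  `[(m,n)=1] = Σ_{b ∣ (m,n), b ≤ B₀} μ(b) + O(τ((m,n)) [ (m,n) > B₀ ])`, the divisibility conditions
  `b ∣ m`, `b ∣ n` being absorbed into the coefficients).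

Also: the trivial bound `BilinBoundedBy.of_norm_le`, sums of kernels `BilinBoundedBy.add/sum`, an
Abel summation inequality `norm_sum_Ioc_mul_le_of_partial` (partial sums `≤ F` ⇒
`‖Σ w(n) a(n)‖ ≤ F (‖w(B)‖ + Σ ‖w(n+1) - w(n)‖)`), and two facts on total variation
(`norm_sub_le_sum_norm_sub`, `variation_comp_mul_le`: the variation of `n ↦ g(qn)` is at most that
of `g`). Everything is PROVED; no named facts, no new definitions.

## References

* J. Friedlander, H. Iwaniec, Ann. of Math. (2) 148 (1998), 945–1040, §23 (proof of Proposition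
  23.1), §25, §26 Lemma 26.1. [FriedlanderIwaniecAnnals1998]
* W. Duke, J. Friedlander, H. Iwaniec, Invent. Math. 128 (1997), 23–43, Lemma 9.

## Tree / Mathlib

Tree: `BilinBoundedBy`, `BilinBoundedBy.twist/mono/nonneg` (`…ThresholdSeparation`), `sepFun`,
`lemma261` (`…SeparationLemma`). Mathlib: `ArithmeticFunction.coe_moebius_mul_coe_zeta`,
`MeasureTheory.integral_finsetSum`, `Integrable.bdd_mul`, `norm_integral_le_of_norm_le`,
`Finset.sum_Ioc_consecutive`.
-/

noncomputable section

open Real Complex MeasureTheory Finset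
open scoped ArithmeticFunction.Moebius

namespace Literature.NumberTheory.Sieve.FriedlanderIwaniecPrimes

variable {ι κ : Type*}

/-! ### Elementary closure properties of `BilinBoundedBy` -/

/-- **Trivial bound**: every bilinear form with coefficients bounded by `1` is at most
`Σ_w Σ_z ‖K(w,z)‖`. [cite: FriedlanderIwaniecAnnals1998, (21.13)] -/
theorem BilinBoundedBy.of_norm_le {K : ι → κ → ℂ} {W : Finset ι} {Z : Finset κ} {L : ι → κ → ℝ}
    (hL : ∀ w ∈ W, ∀ z ∈ Z, ‖K w z‖ ≤ L w z) :
    BilinBoundedBy K W Z (∑ w ∈ W, ∑ z ∈ Z, L w z) := by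
  intro a b ha hb
  refine (norm_sum_le _ _).trans (sum_le_sum fun w hw => (norm_sum_le _ _).trans
    (sum_le_sum fun z hz => ?_))
  rw [norm_mul, norm_mul]
  calc ‖a w‖ * ‖b z‖ * ‖K w z‖ ≤ 1 * 1 * L w z :=
        mul_le_mul (mul_le_mul (ha w) (hb z) (norm_nonneg _) zero_le_one) (hL w hw z hz)
          (norm_nonneg _) (by norm_num)
    _ = L w z := by ring

/-- Sum of two kernels. [cite: FriedlanderIwaniecAnnals1998, (21.13)] -/
theorem BilinBoundedBy.add {K K' : ι → κ → ℂ} {W : Finset ι} {Z : Finset κ} {X X' : ℝ}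
    (h : BilinBoundedBy K W Z X) (h' : BilinBoundedBy K' W Z X') :
    BilinBoundedBy (fun w z => K w z + K' w z) W Z (X + X') := by
  intro a b ha hb
  have hsplit : ∑ w ∈ W, ∑ z ∈ Z, a w * b z * (K w z + K' w z) =
      (∑ w ∈ W, ∑ z ∈ Z, a w * b z * K w z) + ∑ w ∈ W, ∑ z ∈ Z, a w * b z * K' w z := by
    rw [← sum_add_distrib]
    refine sum_congr rfl fun w _ => ?_
    rw [← sum_add_distrib]
    exact sum_congr rfl fun z _ => by ring
  rw [hsplit]
  exact (norm_add_le _ _).trans (add_le_add (h a b ha hb) (h' a b ha hb))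

/-- Scalar multiple of a kernel. [cite: FriedlanderIwaniecAnnals1998, (21.13)] -/
theorem BilinBoundedBy.const_mul {K : ι → κ → ℂ} {W : Finset ι} {Z : Finset κ} {X : ℝ}
    (h : BilinBoundedBy K W Z X) (c : ℂ) :
    BilinBoundedBy (fun w z => c * K w z) W Z (‖c‖ * X) := by
  intro a b ha hb
  have hsplit : ∑ w ∈ W, ∑ z ∈ Z, a w * b z * (c * K w z) =
      c * ∑ w ∈ W, ∑ z ∈ Z, a w * b z * K w z := by
    rw [mul_sum]
    refine sum_congr rfl fun w _ => ?_
    rw [mul_sum]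
    exact sum_congr rfl fun z _ => by ring
  rw [hsplit, norm_mul]
  exact mul_le_mul_of_nonneg_left (h a b ha hb) (norm_nonneg _)

/-- Finite sum of kernels. [cite: FriedlanderIwaniecAnnals1998, (21.13)] -/
theorem BilinBoundedBy.sum {σ : Type*} (s : Finset σ) {K : σ → ι → κ → ℂ} {W : Finset ι}
    {Z : Finset κ} {X : σ → ℝ} (h : ∀ i ∈ s, BilinBoundedBy (K i) W Z (X i)) :
    BilinBoundedBy (fun w z => ∑ i ∈ s, K i w z) W Z (∑ i ∈ s, X i) := by
  classical
  induction s using Finset.induction_on with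
  | empty =>
    intro a b _ _
    simp
  | insert i s hi ih =>
    have h1 : BilinBoundedBy (K i) W Z (X i) := h i (mem_insert_self i s)
    have h2 := ih fun j hj => h j (mem_insert_of_mem hj)
    have := h1.add h2
    rw [sum_insert hi]
    refine fun a b ha hb => le_of_eq_of_le ?_ (this a b ha hb)
    congr 1
    refine sum_congr rfl fun w _ => sum_congr rfl fun z _ => ?_
    simp only [sum_insert hi]

/-- A kernel vanishing on `W × Z` has bound `0`. [cite: FriedlanderIwaniecAnnals1998, (21.13)] -/
theorem BilinBoundedBy.of_eq_zero {K : ι → κ → ℂ} {W : Finset ι} {Z : Finset κ}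
    (h : ∀ w ∈ W, ∀ z ∈ Z, K w z = 0) : BilinBoundedBy K W Z 0 := by
  intro a b _ _
  rw [sum_eq_zero fun w hw => sum_eq_zero fun z hz => by rw [h w hw z hz, mul_zero], norm_zero]

/-- Pointwise equal kernels on `W × Z` have the same bounds. [cite: FriedlanderIwaniecAnnals1998, (21.13)] -/
theorem BilinBoundedBy.congr {K K' : ι → κ → ℂ} {W : Finset ι} {Z : Finset κ} {X : ℝ}
    (h : BilinBoundedBy K W Z X) (hK : ∀ w ∈ W, ∀ z ∈ Z, K w z = K' w z) :
    BilinBoundedBy K' W Z X := by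
  intro a b ha hb
  have := h a b ha hb
  rwa [sum_congr rfl fun w hw => sum_congr rfl fun z hz => by rw [hK w hw z hz]] at this

/-! ### The product cutoff `[u(w) v(z) ≤ y]` (Lemma 26.1) -/

/-- The unimodular phase `k^{it} = e^{it log k}`. [cite: FriedlanderIwaniecAnnals1998, Lemma 26.1] -/
theorem norm_cexp_I_mul_log (t : ℝ) (k : ℕ) : ‖cexp (I * t * Real.log k)‖ = 1 := by
  rw [show I * t * Real.log k = ((t * Real.log k : ℝ) : ℂ) * I by push_cast; ring,
    Complex.norm_exp_ofReal_mul_I]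

/-- **Lemma 26.1 for a product**: for positive integers `m, n` and `y ≥ 1`,
`[mn ≤ y] = ∫ h_y(t) m^{it} n^{it} dt`. [cite: FriedlanderIwaniecAnnals1998, Lemma 26.1] -/
theorem indicator_mul_le_eq_integral {y : ℝ} (hy : 1 ≤ y) {m n : ℕ} (hm : 1 ≤ m) (hn : 1 ≤ n) :
    (if ((m * n : ℕ) : ℝ) ≤ y then (1 : ℂ) else 0) =
      ∫ t : ℝ, sepFun y t * (cexp (I * t * Real.log m) * cexp (I * t * Real.log n)) := by
  obtain ⟨-, -, hid⟩ := lemma261 hy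
  rw [← hid (m * n) (Nat.mul_pos hm hn)]
  refine integral_congr_ae (Filter.Eventually.of_forall fun t => ?_)
  have hm0 : (0 : ℝ) < m := by exact_mod_cast hm
  have hn0 : (0 : ℝ) < n := by exact_mod_cast hn
  simp only
  rw [← Complex.exp_add, Nat.cast_mul, Real.log_mul hm0.ne' hn0.ne']
  push_cast
  ring_nf

/-- **Separation of a product cutoff in a bilinear form** (Lemma 26.1 in action, as in §25 for
`T(c, 𝔡)`, `T(c)` and in §26 for `S₃`): if every bilinear form `Σ_w Σ_z a(w) b(z) K(w,z)` with
`|a|, |b| ≤ 1` is `≤ X`, and `u(w), v(z) ≥ 1` on `W`, `Z`, then for `y ≥ 1` every bilinear form in the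
kernel `[u(w) v(z) ≤ y] K(w,z)` with `|a|, |b| ≤ 1` is `≤ log(6y) · X`.
[cite: FriedlanderIwaniecAnnals1998, Lemma 26.1 / §25] -/
theorem BilinBoundedBy.cutoff {K : ι → κ → ℂ} {W : Finset ι} {Z : Finset κ} {X : ℝ}
    (h : BilinBoundedBy K W Z X) {u : ι → ℕ} {v : κ → ℕ} (hu : ∀ w ∈ W, 1 ≤ u w)
    (hv : ∀ z ∈ Z, 1 ≤ v z) {y : ℝ} (hy : 1 ≤ y) :
    BilinBoundedBy (fun w z => (if ((u w * v z : ℕ) : ℝ) ≤ y then (1 : ℂ) else 0) * K w z) W Z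
      (Real.log (6 * y) * X) := by
  intro a b ha hb
  have hX0 : 0 ≤ X := h.nonneg
  obtain ⟨hHint, hHnorm, -⟩ := lemma261 hy
  set H : ℝ → ℂ := sepFun y with hH
  -- the twisted coefficients
  set at' : ℝ → ι → ℂ := fun t w => a w * cexp (I * t * Real.log (u w)) with hat'
  set bt : ℝ → κ → ℂ := fun t z => b z * cexp (I * t * Real.log (v z)) with hbt
  have hat1 : ∀ t w, ‖at' t w‖ ≤ 1 := fun t w => by
    rw [hat']; simp only; rw [norm_mul, norm_cexp_I_mul_log, mul_one]; exact ha w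
  have hbt1 : ∀ t z, ‖bt t z‖ ≤ 1 := fun t z => by
    rw [hbt]; simp only; rw [norm_mul, norm_cexp_I_mul_log, mul_one]; exact hb z
  -- the bilinear form at frequency `t`
  set S : ℝ → ℂ := fun t => ∑ w ∈ W, ∑ z ∈ Z, at' t w * bt t z * K w z with hS
  have hSbound : ∀ t, ‖S t‖ ≤ X := fun t => h _ _ (hat1 t) (hbt1 t)
  -- each summand as an integral
  have hterm : ∀ w ∈ W, ∀ z ∈ Z,
      a w * b z * ((if ((u w * v z : ℕ) : ℝ) ≤ y then (1 : ℂ) else 0) * K w z) =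
        ∫ t : ℝ, at' t w * bt t z * K w z * H t := by
    intro w hw z hz
    rw [indicator_mul_le_eq_integral hy (hu w hw) (hv z hz), ← integral_mul_const,
      ← integral_const_mul]
    refine integral_congr_ae (Filter.Eventually.of_forall fun t => ?_)
    rw [hat', hbt, hH]
    simp only
    ring
  have hint : ∀ w ∈ W, ∀ z ∈ Z, Integrable fun t : ℝ => at' t w * bt t z * K w z * H t := by
    intro w _ z _
    refine hHint.bdd_mul (c := ‖K w z‖) ?_ (Filter.Eventually.of_forall fun t => ?_)
    · rw [hat', hbt]
      exact Continuous.aestronglyMeasurable (by fun_prop)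
    · rw [norm_mul, norm_mul]
      calc ‖at' t w‖ * ‖bt t z‖ * ‖K w z‖ ≤ 1 * 1 * ‖K w z‖ :=
            mul_le_mul_of_nonneg_right (mul_le_mul (hat1 t w) (hbt1 t z) (norm_nonneg _) zero_le_one)
              (norm_nonneg _)
        _ = ‖K w z‖ := by ring
  -- exchange sum and integral
  have hsum : ∑ w ∈ W, ∑ z ∈ Z, a w * b z * ((if ((u w * v z : ℕ) : ℝ) ≤ y then (1 : ℂ) else 0) * K w z) =
      ∫ t : ℝ, S t * H t := by
    calc ∑ w ∈ W, ∑ z ∈ Z, a w * b z * ((if ((u w * v z : ℕ) : ℝ) ≤ y then (1 : ℂ) else 0) * K w z)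
        = ∑ w ∈ W, ∑ z ∈ Z, ∫ t : ℝ, at' t w * bt t z * K w z * H t :=
          sum_congr rfl fun w hw => sum_congr rfl fun z hz => hterm w hw z hz
      _ = ∑ w ∈ W, ∫ t : ℝ, ∑ z ∈ Z, at' t w * bt t z * K w z * H t :=
          sum_congr rfl fun w hw => (integral_finsetSum Z fun z hz => hint w hw z hz).symm
      _ = ∫ t : ℝ, ∑ w ∈ W, ∑ z ∈ Z, at' t w * bt t z * K w z * H t :=
          (integral_finsetSum W fun w hw => integrable_finsetSum Z fun z hz => hint w hw z hz).symm
      _ = ∫ t : ℝ, S t * H t := by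
          refine integral_congr_ae (Filter.Eventually.of_forall fun t => ?_)
          simp only [hS, sum_mul]
  rw [hsum]
  have hle : ∀ t, ‖S t * H t‖ ≤ X * ‖H t‖ := fun t => by
    rw [norm_mul]; exact mul_le_mul_of_nonneg_right (hSbound t) (norm_nonneg _)
  calc ‖∫ t : ℝ, S t * H t‖ ≤ ∫ t : ℝ, X * ‖H t‖ :=
        norm_integral_le_of_norm_le (hHint.norm.const_mul X) (Filter.Eventually.of_forall hle)
    _ = X * ∫ t : ℝ, ‖H t‖ := integral_const_mul _ _
    _ ≤ X * Real.log (6 * y) := mul_le_mul_of_nonneg_left hHnorm.le hX0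
    _ = Real.log (6 * y) * X := by ring

/-- The cutoff bound for every `y ≥ 0`: for `y < 1` the kernel vanishes (`u v ≥ 1 > y`), and
`log (6 · max y 1) ≥ 0`. [cite: FriedlanderIwaniecAnnals1998, Lemma 26.1 / §25] -/
theorem BilinBoundedBy.cutoff' {K : ι → κ → ℂ} {W : Finset ι} {Z : Finset κ} {X : ℝ}
    (h : BilinBoundedBy K W Z X) {u : ι → ℕ} {v : κ → ℕ} (hu : ∀ w ∈ W, 1 ≤ u w)
    (hv : ∀ z ∈ Z, 1 ≤ v z) (y : ℝ) :
    BilinBoundedBy (fun w z => (if ((u w * v z : ℕ) : ℝ) ≤ y then (1 : ℂ) else 0) * K w z) W Z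
      (Real.log (6 * max y 1) * X) := by
  by_cases hy : 1 ≤ y
  · rw [max_eq_left hy]; exact h.cutoff hu hv hy
  · push Not at hy
    rw [max_eq_right hy.le]
    have h0 : BilinBoundedBy (fun w z => (if ((u w * v z : ℕ) : ℝ) ≤ y then (1 : ℂ) else 0) * K w z)
        W Z 0 := by
      refine BilinBoundedBy.of_eq_zero fun w hw z hz => ?_
      have : ¬ ((u w * v z : ℕ) : ℝ) ≤ y := by
        have h1 : (1 : ℝ) ≤ ((u w * v z : ℕ) : ℝ) := by exact_mod_cast Nat.mul_pos (hu w hw) (hv z hz)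
        linarith
      rw [if_neg this, zero_mul]
    refine h0.mono ?_
    have := Real.log_nonneg (by norm_num : (1 : ℝ) ≤ 6 * 1)
    exact mul_nonneg this h.nonneg

/-! ### A weight of bounded variation on the product `u(w) v(z)` -/

/-- **Abel summation of a weight against cutoffs**: if `g(n) = 0` for `n > U`, then for `k ≥ 1`,
`g(k) = Σ_{1 ≤ y ≤ U} (g(y) - g(y+1)) [k ≤ y]`. [cite: FriedlanderIwaniecAnnals1998, §26 (partial summation)] -/
theorem eq_sum_sub_mul_indicator (g : ℕ → ℂ) {U : ℕ} (hg : ∀ n, U < n → g n = 0) {k : ℕ}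
    (hk : 1 ≤ k) :
    g k = ∑ y ∈ Icc 1 U, (g y - g (y + 1)) * (if k ≤ y then (1 : ℂ) else 0) := by
  by_cases hkU : k ≤ U
  · -- the sum over `y ∈ [k, U]` telescopes
    have hsplit : ∑ y ∈ Icc 1 U, (g y - g (y + 1)) * (if k ≤ y then (1 : ℂ) else 0) =
        ∑ y ∈ Icc k U, (g y - g (y + 1)) := by
      simp_rw [mul_boole]
      rw [← sum_filter]
      have : (Icc 1 U).filter (fun y => k ≤ y) = Icc k U := by
        ext y; simp only [mem_filter, mem_Icc]; omega
      rw [this]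
    rw [hsplit]
    -- telescoping over `Icc k U = Ico k (U+1)`
    have htel : ∀ n, k ≤ n → ∑ y ∈ Ico k n, (g y - g (y + 1)) = g k - g n := by
      intro n hn
      induction n, hn using Nat.le_induction with
      | base => simp
      | succ n hn ih => rw [sum_Ico_succ_top hn, ih]; ring
    have hIcc : Icc k U = Ico k (U + 1) := by ext y; simp only [mem_Icc, mem_Ico]; omega
    rw [hIcc, htel (U + 1) (by omega), hg (U + 1) (by omega), sub_zero]
  · push Not at hkU
    rw [hg k hkU]
    refine (sum_eq_zero fun y hy => ?_).symm
    rw [mem_Icc] at hy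
    rw [if_neg (by omega), mul_zero]

/-- **A weight of bounded variation on the product costs its total variation times `log 6U`**:
if every bilinear form in `K` with `|a|, |b| ≤ 1` is `≤ X`, `u, v ≥ 1` on `W, Z`, and `g` vanishes
beyond `U ≥ 1`, then every bilinear form in `g(u(w) v(z)) K(w,z)` with `|a|, |b| ≤ 1` is at most
`(Σ_{1 ≤ y ≤ U} ‖g(y) - g(y+1)‖) · log(6U) · X` (in §25 the weight is the smooth `g(cℓ)` of (25.1),
separated there "via the Mellin transform"). [cite: FriedlanderIwaniecAnnals1998, §25 (separation of `g(cmn)`)] -/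
theorem BilinBoundedBy.bvWeight {K : ι → κ → ℂ} {W : Finset ι} {Z : Finset κ} {X : ℝ}
    (h : BilinBoundedBy K W Z X) {u : ι → ℕ} {v : κ → ℕ} (hu : ∀ w ∈ W, 1 ≤ u w)
    (hv : ∀ z ∈ Z, 1 ≤ v z) (g : ℕ → ℂ) {U : ℕ} (hU : 1 ≤ U) (hg : ∀ n, U < n → g n = 0) :
    BilinBoundedBy (fun w z => g (u w * v z) * K w z) W Z
      ((∑ y ∈ Icc 1 U, ‖g y - g (y + 1)‖) * Real.log (6 * U) * X) := by
  have hX0 : 0 ≤ X := h.nonneg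
  -- expand the weight
  have hker : ∀ w ∈ W, ∀ z ∈ Z, g (u w * v z) * K w z =
      ∑ y ∈ Icc 1 U, (g y - g (y + 1)) * ((if ((u w * v z : ℕ) : ℝ) ≤ y then (1 : ℂ) else 0) * K w z) := by
    intro w hw z hz
    rw [eq_sum_sub_mul_indicator g hg (Nat.mul_pos (hu w hw) (hv z hz)), sum_mul]
    refine sum_congr rfl fun y _ => ?_
    have : ((u w * v z : ℕ) ≤ y) ↔ (((u w * v z : ℕ) : ℝ) ≤ (y : ℝ)) := by norm_cast
    by_cases hc : u w * v z ≤ y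
    · rw [if_pos hc, if_pos (this.mp hc)]; ring
    · rw [if_neg hc, if_neg (fun h' => hc (this.mpr h'))]; ring
  -- each cutoff kernel is bounded by `log(6y) X ≤ log(6U) X`
  have hy : ∀ y ∈ Icc 1 U, BilinBoundedBy
      (fun w z => (g y - g (y + 1)) * ((if ((u w * v z : ℕ) : ℝ) ≤ y then (1 : ℂ) else 0) * K w z)) W Z
      (‖g y - g (y + 1)‖ * (Real.log (6 * U) * X)) := by
    intro y hy
    rw [mem_Icc] at hy
    have hy1 : (1 : ℝ) ≤ y := by exact_mod_cast hy.1
    have hU0 : (0 : ℝ) < U := by exact_mod_cast hU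
    have hc := (h.cutoff hu hv hy1).mono (X' := Real.log (6 * U) * X) (by
      refine mul_le_mul_of_nonneg_right (Real.log_le_log (by positivity) ?_) hX0
      have : (y : ℝ) ≤ U := by exact_mod_cast hy.2
      linarith)
    exact hc.const_mul _
  have hs := BilinBoundedBy.sum (Icc 1 U) hy
  rw [← sum_mul] at hs
  refine (hs.congr fun w hw z hz => (hker w hw z hz).symm).mono (le_of_eq ?_)
  ring

/-! ### The coprimality condition `(u(w), v(z)) = 1` -/

/-- `Σ_{b ∣ n} μ(b) = [n = 1]` (Mathlib's `μ * ζ = 1`), complex-valued (a private copy of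
`MontgomeryVaughan1975.sum_divisors_moebius_eq`, to keep the imports of this file inside the FI layer). [folklore] -/
private theorem sum_divisors_moebius_complex (n : ℕ) :
    ∑ b ∈ n.divisors, (μ b : ℂ) = if n = 1 then 1 else 0 := by
  have h := congrArg (fun f : ArithmeticFunction ℂ => f n)
    (ArithmeticFunction.coe_moebius_mul_coe_zeta (R := ℂ))
  simpa only [ArithmeticFunction.coe_mul_zeta_apply, ArithmeticFunction.intCoe_apply,
    ArithmeticFunction.one_apply] using h

/-- **Truncated Möbius inversion of the coprimality condition**: for `m ≥ 1`, any `n` and any `B₀`,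
`[(m,n) = 1] = Σ_{b ≤ B₀, b ∣ m, b ∣ n} μ(b) + R` with `|R| ≤ τ((m,n)) · [(m,n) > B₀]`.
[cite: FriedlanderIwaniecAnnals1998, Proposition 23.1 (proof, removal of `(m,n)=1`)] -/
theorem norm_coprime_indicator_sub_le {m n : ℕ} (hm : 1 ≤ m) (B₀ : ℕ) :
    ‖(if Nat.Coprime m n then (1 : ℂ) else 0) -
        ∑ b ∈ Icc 1 B₀, (if b ∣ m ∧ b ∣ n then (μ b : ℂ) else 0)‖ ≤
      if B₀ < Nat.gcd m n then ((Nat.gcd m n).divisors.card : ℝ) else 0 := by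
  have hg0 : Nat.gcd m n ≠ 0 := (Nat.gcd_pos_of_pos_left n (by omega)).ne'
  -- the full Möbius sum over the divisors of the gcd
  have hfull : (if Nat.Coprime m n then (1 : ℂ) else 0) = ∑ b ∈ (Nat.gcd m n).divisors, (μ b : ℂ) := by
    rw [sum_divisors_moebius_complex]
  -- the truncated sum is the sum over the divisors `≤ B₀`
  have htrunc : ∑ b ∈ Icc 1 B₀, (if b ∣ m ∧ b ∣ n then (μ b : ℂ) else 0) =
      ∑ b ∈ (Nat.gcd m n).divisors.filter (· ≤ B₀), (μ b : ℂ) := by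
    rw [← sum_filter]
    refine sum_congr ?_ fun _ _ => rfl
    ext b
    simp only [mem_filter, mem_Icc, Nat.mem_divisors, Nat.dvd_gcd_iff]
    constructor
    · rintro ⟨⟨h1, h2⟩, h3⟩; exact ⟨⟨h3, hg0⟩, h2⟩
    · rintro ⟨⟨h3, -⟩, h2⟩
      exact ⟨⟨Nat.pos_of_dvd_of_pos h3.1 (by omega), h2⟩, h3⟩
  rw [hfull, htrunc, ← sum_filter_add_sum_filter_not (Nat.gcd m n).divisors (· ≤ B₀), add_sub_cancel_left]
  split_ifs with hB
  · calc ‖∑ b ∈ (Nat.gcd m n).divisors.filter (fun b => ¬ b ≤ B₀), (μ b : ℂ)‖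
        ≤ ∑ b ∈ (Nat.gcd m n).divisors.filter (fun b => ¬ b ≤ B₀), ‖(μ b : ℂ)‖ := norm_sum_le _ _
      _ ≤ ∑ b ∈ (Nat.gcd m n).divisors.filter (fun b => ¬ b ≤ B₀), (1 : ℝ) := by
          refine sum_le_sum fun b _ => ?_
          rw [Complex.norm_intCast]
          exact_mod_cast ArithmeticFunction.abs_moebius_le_one
      _ = ((Nat.gcd m n).divisors.filter (fun b => ¬ b ≤ B₀)).card := by simp
      _ ≤ ((Nat.gcd m n).divisors.card : ℝ) := by exact_mod_cast card_le_card (filter_subset _ _)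
  · -- every divisor of the gcd is `≤ gcd ≤ B₀`: the complementary sum is empty
    push Not at hB
    have : (Nat.gcd m n).divisors.filter (fun b => ¬ b ≤ B₀) = ∅ := by
      refine filter_false_of_mem fun b hb => ?_
      rw [not_not]
      exact (Nat.divisor_le hb).trans hB
    rw [this, sum_empty, norm_zero]

/-- **Removal of the coprimality condition** (the device at the end of the proof of Proposition
23.1: "Finally we remove the condition `(m, n) = 1`"): if every bilinear form in `K` with
`|a|, |b| ≤ 1` is `≤ X` and `u ≥ 1` on `W`, then every bilinear form in `[(u(w), v(z)) = 1] K(w,z)`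
with `|a|, |b| ≤ 1` is at most `B₀ X + Σ_{(u,v) > B₀} τ((u, v)) ‖K(w,z)‖` (truncated Möbius
inversion; the divisibility conditions `b ∣ u(w)`, `b ∣ v(z)` go into the coefficients).
[cite: FriedlanderIwaniecAnnals1998, Proposition 23.1 (proof)] -/
theorem BilinBoundedBy.coprime {K : ι → κ → ℂ} {W : Finset ι} {Z : Finset κ} {X : ℝ}
    (h : BilinBoundedBy K W Z X) {u : ι → ℕ} (v : κ → ℕ) (hu : ∀ w ∈ W, 1 ≤ u w) (B₀ : ℕ) :
    BilinBoundedBy (fun w z => (if Nat.Coprime (u w) (v z) then (1 : ℂ) else 0) * K w z) W Z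
      (B₀ * X + ∑ w ∈ W, ∑ z ∈ Z,
        if B₀ < Nat.gcd (u w) (v z) then ((Nat.gcd (u w) (v z)).divisors.card : ℝ) * ‖K w z‖ else 0) := by
  have hX0 : 0 ≤ X := h.nonneg
  -- the truncated Möbius kernels
  have hb : ∀ b ∈ Icc 1 B₀, BilinBoundedBy
      (fun w z => (if b ∣ u w ∧ b ∣ v z then (μ b : ℂ) else 0) * K w z) W Z X := by
    intro b _
    have ht := h.twist (fun w => if b ∣ u w then (μ b : ℂ) else 0) (fun z => if b ∣ v z then (1 : ℂ) else 0)
      (fun w => by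
        split_ifs
        · rw [Complex.norm_intCast]; exact_mod_cast ArithmeticFunction.abs_moebius_le_one
        · simp)
      (fun z => by split_ifs <;> simp)
    refine ht.congr fun w _ z _ => ?_
    by_cases h1 : b ∣ u w <;> by_cases h2 : b ∣ v z <;> simp [h1, h2]
  have hmain := BilinBoundedBy.sum (Icc 1 B₀) hb
  -- the remainder kernel, bounded trivially
  set R : ι → κ → ℂ := fun w z => ((if Nat.Coprime (u w) (v z) then (1 : ℂ) else 0) -
      ∑ b ∈ Icc 1 B₀, (if b ∣ u w ∧ b ∣ v z then (μ b : ℂ) else 0)) * K w z with hR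
  have hrem : BilinBoundedBy R W Z (∑ w ∈ W, ∑ z ∈ Z,
      if B₀ < Nat.gcd (u w) (v z) then ((Nat.gcd (u w) (v z)).divisors.card : ℝ) * ‖K w z‖ else 0) := by
    refine BilinBoundedBy.of_norm_le fun w hw z _ => ?_
    rw [hR]; simp only; rw [norm_mul]
    have := norm_coprime_indicator_sub_le (n := v z) (hu w hw) B₀
    by_cases hB : B₀ < Nat.gcd (u w) (v z)
    · rw [if_pos hB] at this ⊢
      exact mul_le_mul_of_nonneg_right this (norm_nonneg _)
    · rw [if_neg hB] at this ⊢
      rw [le_antisymm this (norm_nonneg _), zero_mul]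
  have := hmain.add hrem
  rw [sum_const, Nat.card_Icc, Nat.add_sub_cancel, nsmul_eq_mul] at this
  refine this.congr fun w _ z _ => ?_
  rw [hR]; simp only
  rw [← sum_mul]
  ring

/-! ### Abel summation -/

/-- **Summation by parts** (identity): with `S(t) = Σ_{A < k ≤ t} a(k)`,
`Σ_{A < n ≤ B} w(n) a(n) = w(B) S(B) - Σ_{A < n < B} (w(n+1) - w(n)) S(n)`. [cite: FriedlanderIwaniecAnnals1998, §26 (partial summation)] -/
theorem sum_Ioc_mul_eq_sub_sum (w a : ℕ → ℂ) {A B : ℕ} (hAB : A ≤ B) :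
    ∑ n ∈ Ioc A B, w n * a n =
      w B * (∑ k ∈ Ioc A B, a k) - ∑ n ∈ Ioo A B, (w (n + 1) - w n) * ∑ k ∈ Ioc A n, a k := by
  induction B, hAB using Nat.le_induction with
  | base => simp
  | succ B hAB ih =>
    rw [sum_Ioc_succ_top (by omega), ih, sum_Ioc_succ_top (by omega)]
    rcases Nat.eq_or_lt_of_le hAB with rfl | hlt
    · have : Ioo A (A + 1) = ∅ := by
        ext n; simp only [mem_Ioo, Finset.notMem_empty, iff_false]; omega
      simp [this]
    · have : Ioo A (B + 1) = insert B (Ioo A B) := by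
        ext n; simp only [mem_Ioo, mem_insert]; omega
      rw [this, sum_insert (by simp)]
      ring

/-- **Abel's inequality**: if all partial sums `Σ_{A < k ≤ t} a(k)` (`A ≤ t ≤ B`) have norm `≤ F`,
then `‖Σ_{A < n ≤ B} w(n) a(n)‖ ≤ F (‖w(B)‖ + Σ_{A < n < B} ‖w(n+1) - w(n)‖)`. [cite: FriedlanderIwaniecAnnals1998, §26 (partial summation)] -/
theorem norm_sum_Ioc_mul_le_of_partial (w a : ℕ → ℂ) {A B : ℕ} (hAB : A ≤ B) {F : ℝ}
    (hF : ∀ t, A ≤ t → t ≤ B → ‖∑ k ∈ Ioc A t, a k‖ ≤ F) :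
    ‖∑ n ∈ Ioc A B, w n * a n‖ ≤ F * (‖w B‖ + ∑ n ∈ Ioo A B, ‖w (n + 1) - w n‖) := by
  rw [sum_Ioc_mul_eq_sub_sum w a hAB]
  refine (norm_sub_le _ _).trans ?_
  have h1 : ‖w B * ∑ k ∈ Ioc A B, a k‖ ≤ F * ‖w B‖ := by
    rw [norm_mul, mul_comm]; exact mul_le_mul_of_nonneg_right (hF B hAB le_rfl) (norm_nonneg _)
  have h2 : ‖∑ n ∈ Ioo A B, (w (n + 1) - w n) * ∑ k ∈ Ioc A n, a k‖ ≤
      F * ∑ n ∈ Ioo A B, ‖w (n + 1) - w n‖ := by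
    refine (norm_sum_le _ _).trans ?_
    rw [Finset.mul_sum]
    refine sum_le_sum fun n hn => ?_
    rw [mem_Ioo] at hn
    rw [norm_mul, mul_comm]
    exact mul_le_mul_of_nonneg_right (hF n hn.1.le (by omega)) (norm_nonneg _)
  linarith

/-! ### Total variation -/

/-- Telescoping triangle inequality: `‖h(b) - h(a)‖ ≤ Σ_{a ≤ j < b} ‖h(j+1) - h(j)‖`. [cite: FriedlanderIwaniecAnnals1998, §25 (separation of `g`)] -/
theorem norm_sub_le_sum_norm_sub (h : ℕ → ℂ) {a b : ℕ} (hab : a ≤ b) :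
    ‖h b - h a‖ ≤ ∑ j ∈ Ico a b, ‖h (j + 1) - h j‖ := by
  induction b, hab using Nat.le_induction with
  | base => simp
  | succ b hab ih =>
    rw [sum_Ico_succ_top hab]
    calc ‖h (b + 1) - h a‖ = ‖(h (b + 1) - h b) + (h b - h a)‖ := by ring_nf
      _ ≤ ‖h (b + 1) - h b‖ + ‖h b - h a‖ := norm_add_le _ _
      _ ≤ _ := by linarith

/-- **The variation of `n ↦ g(qn)` is at most the variation of `g`** (`q ≥ 1`): for `Y` with
`q Y ≤ U`, `Σ_{1 ≤ n < Y} ‖g(q(n+1)) - g(qn)‖ ≤ Σ_{1 ≤ j < U} ‖g(j+1) - g(j)‖`. [cite: FriedlanderIwaniecAnnals1998, §25 (separation of `g`)] -/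
theorem variation_comp_mul_le (g : ℕ → ℂ) {q Y U : ℕ} (hq : 1 ≤ q) (hY : q * Y ≤ U) :
    ∑ n ∈ Ico 1 Y, ‖g (q * (n + 1)) - g (q * n)‖ ≤ ∑ j ∈ Ico 1 U, ‖g (j + 1) - g j‖ := by
  -- each term is bounded by the variation over the block `[qn, q(n+1))`, and the blocks are disjoint
  have hblock : ∀ n ∈ Ico 1 Y, ‖g (q * (n + 1)) - g (q * n)‖ ≤
      ∑ j ∈ Ico (q * n) (q * (n + 1)), ‖g (j + 1) - g j‖ :=
    fun n _ => norm_sub_le_sum_norm_sub g (Nat.mul_le_mul_left q (Nat.le_succ n))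
  refine (sum_le_sum hblock).trans ?_
  rw [← sum_biUnion]
  · refine sum_le_sum_of_subset_of_nonneg ?_ fun _ _ _ => norm_nonneg _
    intro j hj
    rw [mem_biUnion] at hj
    obtain ⟨n, hn, hj⟩ := hj
    rw [mem_Ico] at hn hj ⊢
    constructor
    · have : q * 1 ≤ q * n := Nat.mul_le_mul_left q hn.1
      omega
    · have : q * (n + 1) ≤ q * Y := Nat.mul_le_mul_left q hn.2
      omega
  · intro n _ n' _ hne
    simp only [Function.onFun]
    rw [disjoint_left]
    intro j hj hj'
    rw [mem_Ico] at hj hj'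
    rcases lt_or_gt_of_ne hne with hlt | hlt
    · have : q * (n + 1) ≤ q * n' := Nat.mul_le_mul_left q hlt
      omega
    · have : q * (n' + 1) ≤ q * n := Nat.mul_le_mul_left q hlt
      omega

end Literature.NumberTheory.Sieve.FriedlanderIwaniecPrimes
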